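import Mathlib
import HarnessLib

/-!
# Route ParityLeakOneFifth, crux `ParityLeakSieve` (stmt-Parity-18381), skeleton `birth`:
# growth lemmas and the final arithmetic of the Type-I comparison of stub S1

* `exists_pow_le_mul_exp` — `ℓⁿ ≤ κ e^{aℓ}` for `ℓ ≥ L₀(n, κ, a)`;
* `exp_neg_inv_le` — `e^{−1/ε} ≤ 6ε³` for `ε > 0`;
* `typeI_final_arith` — the assembly of the five smallness conditions into `≤ δ x/log x`.
-/

namespace Summit.Parity.GeneralizedHardyLittlewood.Theorems.ParityLeakOneFifth

open Real

/-- For `κ, a > 0` and `n : ℕ` there is `L₀` with `ℓⁿ ≤ κ·e^{aℓ}` for all `ℓ ≥ L₀`. -/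
theorem exists_pow_le_mul_exp (n : ℕ) {κ a : ℝ} (hκ : 0 < κ) (ha : 0 < a) :
    ∃ L₀ : ℝ, 1 ≤ L₀ ∧ ∀ ℓ : ℝ, L₀ ≤ ℓ → ℓ ^ n ≤ κ * Real.exp (a * ℓ) := by
  -- `(aℓ)^{n+1}/(n+1)! ≤ e^{aℓ}`, so `ℓⁿ ≤ (n+1)!/(a^{n+1} ℓ) e^{aℓ} ≤ κ e^{aℓ}` once `ℓ ≥ (n+1)!/(κ a^{n+1})`
  set M : ℝ := ((n + 1).factorial : ℝ) / (κ * a ^ (n + 1)) with hM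
  have hM0 : 0 < M := by positivity
  refine ⟨max 1 M, le_max_left _ _, fun ℓ hℓ => ?_⟩
  have hℓ1 : 1 ≤ ℓ := (le_max_left _ _).trans hℓ
  have hℓM : M ≤ ℓ := (le_max_right _ _).trans hℓ
  have hℓ0 : 0 < ℓ := by linarith
  have h := Real.pow_div_factorial_le_exp (a * ℓ) (by positivity) (n + 1)
  have hf : (0 : ℝ) < ((n + 1).factorial : ℝ) := by positivity
  rw [div_le_iff₀ hf, mul_pow] at h
  -- `a^{n+1} ℓ^{n+1} ≤ e^{aℓ} (n+1)!` and `(n+1)! ≤ κ a^{n+1} ℓ`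
  have hMℓ : ((n + 1).factorial : ℝ) ≤ κ * a ^ (n + 1) * ℓ := by
    have := (div_le_iff₀ (by positivity : 0 < κ * a ^ (n + 1))).1 hℓM
    linarith
  have hkey : a ^ (n + 1) * ℓ ^ (n + 1) ≤ Real.exp (a * ℓ) * (κ * a ^ (n + 1) * ℓ) :=
    h.trans (mul_le_mul_of_nonneg_left hMℓ (Real.exp_pos _).le)
  have han : 0 < a ^ (n + 1) := by positivity
  -- divide by `a^{n+1} ℓ`
  have : ℓ ^ (n + 1) ≤ ℓ * (κ * Real.exp (a * ℓ)) := by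
    have e : Real.exp (a * ℓ) * (κ * a ^ (n + 1) * ℓ) = a ^ (n + 1) * (ℓ * (κ * Real.exp (a * ℓ))) := by ring
    rw [e] at hkey
    exact le_of_mul_le_mul_left hkey han
  rw [pow_succ'] at this
  exact le_of_mul_le_mul_left this hℓ0

/-- `e^{−1/ε} ≤ 6 ε³` for `ε > 0` (from `u³/6 ≤ e^u`). -/
theorem exp_neg_inv_le {ε : ℝ} (hε : 0 < ε) : Real.exp (-(1 / ε)) ≤ 6 * ε ^ 3 := by
  have h := Real.pow_div_factorial_le_exp (1 / ε) (by positivity) 3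
  norm_num [Nat.factorial] at h
  -- `h : (ε ^ 3)⁻¹ / 6 ≤ rexp ε⁻¹` (or an equivalent normal form)
  rw [Real.exp_neg, inv_le_comm₀ (Real.exp_pos _) (by positivity)]
  have e : (6 * ε ^ 3)⁻¹ = (ε ^ 3)⁻¹ / 6 := by
    rw [mul_inv, div_eq_mul_inv, mul_comm]
  rw [e, one_div]
  exact h

/-- `ℓ + M ≤ (log ℓ)²`-type: for `t ≥ 2` and `t ≥ M`, `t + M ≤ t²`. -/
theorem add_le_sq_of_le {t M : ℝ} (ht : 2 ≤ t) (hM : M ≤ t) : t + M ≤ t ^ 2 := by nlinarith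

/-- The final arithmetic of `typeI_diff_le`, over real variables. -/
theorem typeI_final_arith {T S₁ Φ₁ x ℓ BV DLΔ DΦ δ A B : ℝ}
    (hT : T ≤ x * S₁ * Φ₁ + 2 * BV + DLΔ + DΦ)
    (hΦ₁ : Φ₁ = A + B) (hA : S₁ * A ≤ δ / (5 * ℓ)) (hB : S₁ * B ≤ δ / (5 * ℓ))
    (hBV : 2 * BV ≤ δ / 5 * x / ℓ) (hDL : DLΔ ≤ δ / 5 * x / ℓ) (hDΦ : DΦ ≤ δ / 5 * x / ℓ)
    (hx : 0 < x) (hℓ : 0 < ℓ) : T ≤ δ * x / ℓ := by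
  have h1 : x * S₁ * Φ₁ ≤ 2 * (δ / 5 * x / ℓ) := by
    rw [hΦ₁]
    have e : x * S₁ * (A + B) = x * (S₁ * A) + x * (S₁ * B) := by ring
    rw [e]
    have hA' := mul_le_mul_of_nonneg_left hA hx.le
    have hB' := mul_le_mul_of_nonneg_left hB hx.le
    have e2 : x * (δ / (5 * ℓ)) = δ / 5 * x / ℓ := by field_simp
    linarith
  have e : δ * x / ℓ = 5 * (δ / 5 * x / ℓ) := by ring
  linarith

end Summit.Parity.GeneralizedHardyLittlewood.Theorems.ParityLeakOneFifth
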